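import Summits.QuantumFields.YangMills.Theorems.LuscherReductionTwistedTraceScalingBODefectHODFixedMagnetic
import Summits.QuantumFields.YangMills.Theorems.LuscherReductionTwistedTraceScalingBODefectHOD
import Summits.QuantumFields.YangMills.Theorems.LuscherReductionTwistedTraceScalingBODefectCoreCurrency
import Summits.QuantumFields.YangMills.Theorems.LuscherReductionTwistedTraceScalingBODefectTailPiece
import Summits.QuantumFields.YangMills.Theorems.LuscherReductionTwistedTraceScalingBODefectTailSchedule
import Summits.QuantumFields.YangMills.Theorems.LuscherReductionTwistedTraceScalingBODefectOutPiece
import Summits.QuantumFields.YangMills.Theorems.LuscherReductionTwistedTraceScalingBODefectShellB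
import Summits.QuantumFields.YangMills.Theorems.TwistedTraceScaling.Negative.OutPieceMagneticBound
import Summits.QuantumFields.YangMills.Theorems.LuscherReductionTwistedTraceScalingBOCurrencyFloorZ
import Summits.QuantumFields.YangMills.Theorems.LuscherReductionTwistedTraceScalingBODefectRecordData
import Summits.QuantumFields.YangMills.Theorems.LuscherReductionTwistedTraceScalingBODefectCoreRateLow
import Summits.QuantumFields.YangMills.Theorems.LuscherReductionTwistedTraceScalingBODefectOutRateMagnetic
import Summits.QuantumFields.YangMills.Theorems.TwistedTraceScaling.Negative.RecordInputExponentWindow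
import Summits.QuantumFields.YangMills.Theorems.LuscherReductionTwistedTraceScalingBODefectShellRate
import Summits.QuantumFields.YangMills.Theorems.LuscherReductionTwistedTraceScalingFPWeightCore
import HarnessLib

/-!
# (C4-SHELL, H2 «hOD below 1/6», part 4 — ASSEMBLED) THE OFF-DIAGONAL BRICK `hOD` OF THE RECORD FOR EVERY TUBE EXPONENT `0 < s < 1/4`, WITH AN EXPLICIT POLYNOMIAL RATE
# (lane A of S-BASE, crux `TwistedTraceScaling` stmt-QuantumFields-20203, C4-SHELL; lead g23 card `pub/ym-fleet/ym-luscher-20007-p1/Lines-shell-gain.md` §3–§4 (HANDS WANTED H2); cdisprove UPDATE 29 (C),(D); hand A `…-w1` g2)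

The landed ✓`…BODefectHOD.hOD_record` (g20) is stated for `1/6 < s < 1/4`; the audit (hand A + cdisprove UPDATE 29 (D)) shows that `1/6 < s` enters at exactly two places:
(γ) the stiff-separation kernel bound ✓`hsep_record` (`β^{−(3s−1/2)} → 0`), and (β) the QUALITATIVE rate clause `b² = o(λ_b)` via ✓`core_rate_small` (`β^{-2s} = o(β^{-1/3})`).  For the thin
exponent-shells of the C4-SHELL cut both are replaced: (γ) by cdisprove R59 ✓`…Negative.OutPieceMagneticBound.eventually_hsep_magnetic` (the MAGNETIC separation constant
`K_sep = e^{2β|E|}e^{−(β/2)(gap/16)(r_F/12)²}`, valid for EVERY `s > 0`; the outer piece and the fixed-β defect clause re-instantiated as ✓`out_rate_small_magnetic`, ✓`hdef_fixed_magnetic`),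
and (β) by the EXPLICIT polynomial size of the rate, which is what the lead's `ShellBricks.hdom` (DOMINATION) consumes:
★★★ `hOD_record_low (hLz) (hL2 : 2 ≤ L) (hs0 : 0 < s) (hs4 : s < 1/4)` — `∃ M₀ ≥ 2, ∀ M ≥ M₀, ∃ b ≥ 0, (∀ p, p < 2s → p < 1/3 → ∀ᶠ β, b β² ≤ powScale p β) ∧ ∀ᶠ β, ⟨the (OD) clause of
`RecordAnalyticInput.hOD` for the cap-restricted frozen stiff-Gaussian profile of record, literal currency `Λ = (btC/fpZ(btEps)/recordGamma)·λ₀(1,L³β)`, VERBATIM as in ✓`hOD_record`⟩`.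
The rate is `b = √(2(b_core² + b_T² + b_O² + b_B²))` with `b_core² ≤ β^{-p'}` for every `p' < min(2s, 2/5)` (✓`core_rate_sq_le_powScale`), and `b_T², b_O², b_B² = o(λ_b)`
(✓`tail_rate_small`, ✓`out_rate_small_magnetic`, ✓`shell_rate_small`, all `0 < s`) with `λ_b(L³β) ≤ 2β^{-1/3}` (✓`Negative.bareLambda_cube_mul_le`); the proof body is otherwise the g20
template (`pub/ym-fleet/ym-luscher-20007-p1/g20-work/tools`, regenerated with the two substitutions; every other input is stated for `0 < s ≤ 1/3` or `s < 1/2`).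
At `1/6 < s < 1/4` this is consistent with ✓`hOD_record` (`β^{-p} = o(λ_b)` for `p > 1/3` is then available); below `1/6` the rate is `β^{-s}·polylog`, NOT `o(λ_b)`.
HONEST FRAMING: re-instantiation at smaller tube exponents of the fixed-`L` (OD) brick of a stub of a child of the CONDITIONAL route R2b1 (Lüscher two-lattice reduction); the thin shells
below `1/6`, C4-SHELL, COARSE-UPPER/LOWER/TAIL, the crux remain OPEN; not infinite volume, not a mass gap, not Clay.
-/

set_option autoImplicit false

noncomputable section

open MeasureTheory Filter Topology Real
open scoped BigOperators
open Literature.MathematicalPhysics.QuantumFieldTheory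
open Literature.MathematicalPhysics.QuantumLattice

namespace Summit.QuantumFields.YangMills.Theorems.FemtoTransferGap.TwoLattice.ConstTube

open Summit.QuantumFields.YangMills.Theorems.FemtoTransferGap
open Summit.QuantumFields.YangMills.Theorems.FemtoTransferGap.TwoLattice
open Summit.QuantumFields.YangMills.Theorems.FemtoTransferGap.TwoLattice.Avg
open Summit.QuantumFields.YangMills.Theorems.FemtoTransferGap.TwoLattice.Stiff
open Summit.QuantumFields.YangMills.Theorems.FemtoTransferGap.TwoLattice.GnChart
open Summit.QuantumFields.YangMills.Theorems.FemtoTransferGap.TwoLattice.Cov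

variable {L : ℕ} [NeZero L]

omit [NeZero L] in
/-- **The combined rate is below a scale when each piece is below an eighth of it.** [folklore] -/
theorem rate_le_of_pieces {B b₁ b₂ b₃ b₄ : ℝ → ℝ}
    (h₁ : ∀ᶠ β in atTop, b₁ β ^ 2 ≤ B β / 8) (h₂ : ∀ᶠ β in atTop, b₂ β ^ 2 ≤ B β / 8)
    (h₃ : ∀ᶠ β in atTop, b₃ β ^ 2 ≤ B β / 8) (h₄ : ∀ᶠ β in atTop, b₄ β ^ 2 ≤ B β / 8) :
    ∀ᶠ β in atTop, Real.sqrt (2 * (b₁ β ^ 2 + b₂ β ^ 2 + b₃ β ^ 2 + b₄ β ^ 2)) ^ 2 ≤ B β := by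
  filter_upwards [h₁, h₂, h₃, h₄] with β e₁ e₂ e₃ e₄
  rw [Real.sq_sqrt (by positivity)]
  linarith

set_option maxHeartbeats 6400000 in
-- the assembly of ~20 eventual bricks with very large record expressions.
/-- ★★★ **THE (OD) BRICK OF RECORD, EVERY EXPONENT `0 < s < 1/4`, EXPLICIT RATE, ASSEMBLED** (see the module docstring). [cite: Luscher1983, §3] -/
theorem hOD_record_low (hLz : Nonempty (NzSite L)) (hL2 : 2 ≤ L) {s : ℝ} (hs0 : 0 < s) (hs4 : s < 1 / 4) :
    ∃ M₀ : ℝ, 2 ≤ M₀ ∧ ∀ M : ℝ, M₀ ≤ M → ∃ b : ℝ → ℝ, (∀ β, 0 ≤ b β) ∧ (∀ p : ℝ, p < 2 * s → p < 1 / 3 → ∀ᶠ β : ℝ in atTop, b β ^ 2 ≤ powScale p β) ∧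
      ∀ᶠ β : ℝ in atTop, ∀ (φ : GaugeConfig 3 1 SU2 → ℝ) (v : GaugeConfig 3 L SU2 → ℝ), Measurable φ → (∃ C : ℝ, ∀ u, |φ u| ≤ C) → (∀ u, φ u ≠ 0 → orbitDist u < recordDelta1 L s β) → Measurable v → (∃ C : ℝ, ∀ U, |v U| ≤ C) → (∀ U, v U ≠ 0 → (recordChi L s 43 M β) U ≠ 0) → (∀ u, fibreInner L (softWeight (recordChi L s 43 M β)) (fun x : LinkSpace L => {x : LinkSpace L | linkCurry x ∈ capBalancedSet L}.indicator (fun _ => (1 : ℝ)) x * frozenProfile L (fun β' => stiffGaussExp L (β' / 2) β') (fun β' => min (1 / 40) (powScale (1 / 2) β' * btLog β')) β x) v u = 0) → |tubeCross β (boFun L φ (fun x : LinkSpace L => {x : LinkSpace L | linkCurry x ∈ capBalancedSet L}.indicator (fun _ => (1 : ℝ)) x * frozenProfile L (fun β' => stiffGaussExp L (β' / 2) β') (fun β' => min (1 / 40) (powScale (1 / 2) β' * btLog β')) β x)) v| ≤ b β * ((btC L β (fun x : LinkSpace L => {x : LinkSpace L | linkCurry x ∈ capBalancedSet L}.indicator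 (fun _ => (1 : ℝ)) x * frozenProfile L (fun β' => stiffGaussExp L (β' / 2) β') (fun β' => min (1 / 40) (powScale (1 / 2) β' * btLog β')) β x) (btEps β) (5 * (powScale (1 / 2) β * btLog β ^ 2)) / fpZ (btEps β) / recordGamma L (fun β' => fun x : LinkSpace L => {x : LinkSpace L | linkCurry x ∈ capBalancedSet L}.indicator (fun _ => (1 : ℝ)) x * frozenProfile L (fun β'' => stiffGaussExp L (β'' / 2) β'') (fun β'' => min (1 / 40) (powScale (1 / 2) β'' * btLog β'')) β' x) β) * levelValue su2Rep 1 ((L : ℝ) ^ 3 * β) 0) * Real.sqrt (tubeNormSq (softWeight (recordChi L s 43 M β)) (boFun L φ (fun x : LinkSpace L => {x : LinkSpace L | linkCurry x ∈ capBalancedSet L}.indicator (fun _ => (1 : ℝ)) x * frozenProfile L (fun β' => stiffGaussExp L (β' / 2) β') (fun β' => min (1 / 40) (powScale (1 / 2) β' * btLog β')) β x))) * Real.sqrt (tubeNormSq (softWeight (recordChi L s 43 M β)) v) ∧ |tubeCross β v (boFun L φ (fun x : LinkSpace L => {x : LinkSpace L | linkCurry x ∈ capBalancedSet L}.indicator (fun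 _ => (1 : ℝ)) x * frozenProfile L (fun β' => stiffGaussExp L (β' / 2) β') (fun β' => min (1 / 40) (powScale (1 / 2) β' * btLog β')) β x))| ≤ b β * ((btC L β (fun x : LinkSpace L => {x : LinkSpace L | linkCurry x ∈ capBalancedSet L}.indicator (fun _ => (1 : ℝ)) x * frozenProfile L (fun β' => stiffGaussExp L (β' / 2) β') (fun β' => min (1 / 40) (powScale (1 / 2) β' * btLog β')) β x) (btEps β) (5 * (powScale (1 / 2) β * btLog β ^ 2)) / fpZ (btEps β) / recordGamma L (fun β' => fun x : LinkSpace L => {x : LinkSpace L | linkCurry x ∈ capBalancedSet L}.indicator (fun _ => (1 : ℝ)) x * frozenProfile L (fun β'' => stiffGaussExp L (β'' / 2) β'') (fun β'' => min (1 / 40) (powScale (1 / 2) β'' * btLog β'')) β' x) β) * levelValue su2Rep 1 ((L : ℝ) ^ 3 * β) 0) * Real.sqrt (tubeNormSq (softWeight (recordChi L s 43 M β)) (boFun L φ (fun x : LinkSpace L => {x : LinkSpace L | linkCurry x ∈ capBalancedSet L}.indicator (fun _ => (1 : ℝ)) x * frozenProfile L (fun β' => stiffGaussExp L (β' / 2)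 β') (fun β' => min (1 / 40) (powScale (1 / 2) β' * btLog β')) β x))) * Real.sqrt (tubeNormSq (softWeight (recordChi L s 43 M β)) v) := by
  have hs3 : s ≤ 1 / 3 := by linarith
  have hs2 : s < 1 / 2 := by linarith
  set N : ℝ := (Fintype.card (Site 3 L) : ℝ) with hNdef
  have hN : 0 < N := by rw [hNdef]; exact_mod_cast Fintype.card_pos
  have hN1 : 1 ≤ N := by rw [hNdef]; exact_mod_cast Fintype.card_pos
  have hL1 : (1 : ℝ) ≤ L := by exact_mod_cast NeZero.one_le
  have hL3 : (1 : ℝ) ≤ (L : ℝ) ^ 3 := one_le_pow₀ hL1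
  have hD0 : (0 : ℝ) ≤ (517 / (Fintype.card (Site 3 L) : ℝ)) := by positivity
  have hD14 : 14 / (Fintype.card (Site 3 L) : ℝ) ≤ (517 / (Fintype.card (Site 3 L) : ℝ)) := div_le_div_of_nonneg_right (by norm_num) hN.le
  -- the constants of the bricks
  obtain ⟨M₁, hM₁, hcoreM⟩ := core_defect_currency (L := L) hLz hL2 hs0 hs3
  obtain ⟨M₂, hM₂, hnormM⟩ := tubeNormSq_record_ge (L := L) hLz hs0 hs3
  obtain ⟨M₃, hM₃, hflM⟩ := currency_floor (L := L) hLz hs0 hs3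
  obtain ⟨M₄, hM₄, hfliM⟩ := currency_floor_inv (L := L) hLz hs0 hs3
  have hδ0 : ∀ β, 0 < (fun β : ℝ => 43 * powScale s β) β := fun β => mul_pos (by norm_num) (powScale_pos _ _)
  have hδt : Tendsto (fun β : ℝ => 43 * powScale s β) atTop (𝓝 0) := by simpa using (tendsto_powScale (σ := s) hs0).const_mul 43
  have hsd : ∀ᶠ β in atTop, 0 < powScale 1 β ∧ powScale 1 β ≤ (fun β : ℝ => 43 * powScale s β) β ^ 3 := by
    filter_upwards [eventually_ge_atTop (1 : ℝ)] with β hβ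
    refine ⟨powScale_pos _ _, ?_⟩
    have h1 : powScale 1 β ≤ powScale s β ^ 3 := powScale_one_le_cube hs3 hβ
    have h2 : powScale s β ^ 3 ≤ (43 * powScale s β) ^ 3 :=
      pow_le_pow_left₀ (powScale_pos _ _).le (le_mul_of_one_le_left (powScale_pos _ _).le (by norm_num)) 3
    exact h1.trans h2
  obtain ⟨M₅, hM₅, hPM⟩ := fpWeight_core_constant L hLz hδ0 hδt hsd
  refine ⟨max (max (max M₁ M₂) (max M₃ M₄)) M₅, le_trans hM₁ (le_trans (le_max_left _ _) (le_trans (le_max_left _ _) (le_max_left _ _))), fun M hM => ?_⟩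
  have hMM1 : M₁ ≤ M := le_trans (le_trans (le_max_left _ _) (le_max_left _ _)) (le_trans (le_max_left _ _) hM)
  have hMM2 : M₂ ≤ M := le_trans (le_trans (le_max_right _ _) (le_max_left _ _)) (le_trans (le_max_left _ _) hM)
  have hMM3 : M₃ ≤ M := le_trans (le_trans (le_max_left _ _) (le_max_right _ _)) (le_trans (le_max_left _ _) hM)
  have hMM4 : M₄ ≤ M := le_trans (le_trans (le_max_right _ _) (le_max_right _ _)) (le_trans (le_max_left _ _) hM)
  have hMM5 : M₅ ≤ M := le_trans (le_max_right _ _) hM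
  have hM0 : 0 ≤ M := by linarith
  obtain ⟨c₁, Cp, Cq, hCp, hCq, hcoreE⟩ := hcoreM M hMM1 (517 / (Fintype.card (Site 3 L) : ℝ)) hD0
  obtain ⟨Cn, hCn, hnormE⟩ := hnormM M hMM2
  obtain ⟨cR, K, hcR, hflE⟩ := hflM M hMM3
  obtain ⟨cR', K', hcR', hfliE⟩ := hfliM M hMM4
  obtain ⟨Cw, β₀, hCw, hPF⟩ := hPM M hMM5
  obtain ⟨q₀, hq₀, htailE⟩ := eventually_tail_schedule (L := L) hs0 hs2 (Dδ := (517 / (Fintype.card (Site 3 L) : ℝ))) hD14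
  obtain ⟨B₀, hB₀, hCE⟩ := PolyakovLift.exists_linkCE_le_two_mul_levelValue_zero
  obtain ⟨Cb, Kb, hCb, hbtCfl⟩ := btC_record_poly_floor (L := L)
  -- the rate
  refine ⟨fun β => Real.sqrt (2 * (((max (1 - Real.exp (-(coreEta L β ((517 / (Fintype.card (Site 3 L) : ℝ)) * powScale s β) (((517 / (Fintype.card (Site 3 L) : ℝ)) * powScale s β) + (14 * powScale s β)) (9 * (L : ℝ) * (5 * (powScale (1 / 2) β * btLog β ^ 2)) + (powScale 1 β)) (min (1 / 40) (powScale (1 / 2) β * btLog β)) ((powScale 1 β) * Fintype.card (Site 3 L)) (powScale (2 * s) β) + coreEps1 L β ((517 / (Fintype.card (Site 3 L) : ℝ)) * powScale s β) (9 * (L : ℝ) * (5 * (powScale (1 / 2) β * btLog β ^ 2)) + (powScale 1 β)) (min (1 / 40) (powScale (1 / 2) β * btLog β)) + coreEps2 L β ((517 / (Fintype.card (Site 3 L) : ℝ)) * powScale s β) (9 * (L : ℝ) * (5 * (powScale (1 / 2) β * btLog β ^ 2)) + (powScale 1 β)) (min (1 / 40) (powScale (1 / 2) β * btLog β)) (powScale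 (2 * s) β))) * (1 - powScale (1 / 5) β)) (Real.exp (coreEta L β ((517 / (Fintype.card (Site 3 L) : ℝ)) * powScale s β) (((517 / (Fintype.card (Site 3 L) : ℝ)) * powScale s β) + (14 * powScale s β)) (9 * (L : ℝ) * (5 * (powScale (1 / 2) β * btLog β ^ 2)) + (powScale 1 β)) (min (1 / 40) (powScale (1 / 2) β * btLog β)) ((powScale 1 β) * Fintype.card (Site 3 L)) (powScale (2 * s) β) + coreEps1 L β ((517 / (Fintype.card (Site 3 L) : ℝ)) * powScale s β) (9 * (L : ℝ) * (5 * (powScale (1 / 2) β * btLog β ^ 2)) + (powScale 1 β)) (min (1 / 40) (powScale (1 / 2) β * btLog β)) + coreEps2 L β ((517 / (Fintype.card (Site 3 L) : ℝ)) * powScale s β) (9 * (L : ℝ) * (5 * (powScale (1 / 2) β * btLog β ^ 2)) + (powScale 1 β)) (min (1 / 40) (powScale (1 / 2) β * btLog β)) (powScale (2 * s) β)) * (1 + powScale (1 / 5) β) - 1) + (Cp * (43 * powScale s β) ^ 2)) * Real.sqrt (8 / ((1 - (Cp * (43 * powScale s β) ^ 2)) * (1 - powScale (1 / 5) β) ^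 2 * (1 - (Cq * (43 * powScale s β) ^ 2))))) ^ 2 + Real.sqrt (((Real.exp (β * (2 * (Fintype.card (Edge 3 L) : ℝ))) * (Real.exp (-(β * btMnt L ((517 / (Fintype.card (Site 3 L) : ℝ)) * powScale s β) (powScale (1 / 2) β * btLog β ^ 2) (min (1 / 40) (powScale (1 / 2) β * btLog β)) (5 * (powScale (1 / 2) β * btLog β ^ 2)) (powScale 1 β))) + Real.exp (-(β * btMfar L ((517 / (Fintype.card (Site 3 L) : ℝ)) * powScale s β) (powScale (1 / 2) β * btLog β ^ 2) (min (1 / 40) (powScale (1 / 2) β * btLog β)) (powScale 1 β) (13 * ((517 / (Fintype.card (Site 3 L) : ℝ)) * powScale s β))))) * ∫ v, (fun x : LinkSpace L => {x : LinkSpace L | linkCurry x ∈ capBalancedSet L}.indicator (fun _ => (1 : ℝ)) x * frozenProfile L (fun β' => stiffGaussExp L (β' / 2) β') (fun β' => min (1 / 40) (powScale (1 / 2) β' * btLog β')) β x) (linkEmbed L v) ∂orthoTransverse L) ^ 2 * (1 / (fpWeightBar L (powScale 1 β) * (1 - (Cw * (43 * powScale s β) ^ 2))))) / (cR' * powScale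 1 β ^ K' * (Real.exp (2 * β) ^ Fintype.card (Edge 3 L)) ^ 2)) ^ 2 + Real.sqrt ((3 * ((orthoTransverse L Set.univ).toReal * (1 / (fpWeightBar L (powScale 1 β) * (1 - (Cw * (43 * powScale s β) ^ 2)))) * ((Real.exp (2 * β) ^ Fintype.card (Edge 3 L)) ^ 2 * (Real.exp (-(β * (2 - 2 * Real.cos (2 * Real.pi / L)) * ((min (1 / 40) (powScale (1 / 2) β * btLog β)) / 12 / 2) ^ 2)) + Real.exp (-(((powScale 1 β) * btLog β) ^ 2 / powScale 1 β ^ 2)) ^ 2 + Real.exp (-(((powScale 1 β) * btLog β) ^ 2 / powScale 1 β ^ 2))) + (Real.exp (2 * β) ^ Fintype.card (Edge 3 L)) * ((Real.exp (2 * β) ^ Fintype.card (Edge 3 L)) * Real.exp (-(β / 2 * ((2 - 2 * Real.cos (2 * Real.pi / L)) / 16 * ((min (1 / 40) (powScale (1 / 2) β * btLog β)) / 12) ^ 2))))))) / (cR * powScale 1 β ^ K * (Real.exp (2 * β) ^ Fintype.card (Edge 3 L)) ^ 2)) ^ 2 + Real.sqrt (8 * (fpWeightBar L (powScale 1 β)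 * (1 + (Cw * (43 * powScale s β) ^ 2))) * (Real.exp (-(β * (2 - 2 * Real.cos (2 * Real.pi / L)) * ((min (1 / 40) (powScale (1 / 2) β * btLog β)) / 12) ^ 2)) * (orthoTransverse L Set.univ).toReal) / ((1 - powScale (1 / 5) β) ^ 2 * (1 - (Cn * (43 * powScale s β) ^ 2)) * (∫ v, {v : Edge 3 L → Fin 3 → ℝ | ‖linkEmbed L v‖ ≤ (min (1 / 40) (powScale (1 / 2) β * btLog β)) / 12}.indicator (fun _ => (1 : ℝ)) v * (Real.exp (-(stiffGaussExp L (β / 2) β (linkEmbed L v))) ^ 2 * Real.exp (-(‖(gaugeModes L).starProjection (linkEmbed L v)‖ ^ 2 / powScale 1 β ^ 2))) ∂orthoTransverse L) * fpWeightBar L (powScale 1 β))) ^ 2)), fun β => Real.sqrt_nonneg _, ?_, ?_⟩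
  · -- `b² = 2(b_core² + b_T² + b_O² + b_B²) ≤ β^{-p}` eventually, for every `p < min(2s, 1/3)`
    intro p hp2 hp3
    have hlam0 : ∀ᶠ β : ℝ in atTop, 0 ≤ bareLambda ((L : ℝ) ^ 3 * β) := by
      filter_upwards [eventually_ge_atTop (2 : ℝ)] with β hβ2
      exact (bareLambda_pos_le_one (by nlinarith)).1.le
    -- `λ_b ≤ 2β^{-1/3} ≤ β^{-p}/8` eventually
    obtain ⟨βl, hβl⟩ := Summit.QuantumFields.YangMills.Theorems.TwistedTraceScaling.Negative.R23.mul_powScale_le_eventually (a := 1 / 3) (b := p) hp3 2 (D := 1 / 8) (by norm_num)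
    have hlam : ∀ᶠ β : ℝ in atTop, 1 * bareLambda ((L : ℝ) ^ 3 * β) ≤ powScale p β / 8 := by
      filter_upwards [eventually_ge_atTop (1 : ℝ), eventually_ge_atTop βl] with β hβ1 hββl
      have h1 := Summit.QuantumFields.YangMills.Theorems.TwistedTraceScaling.Negative.R37.bareLambda_cube_mul_le (L := L) hβ1
      have h2 : (2 : ℝ) * β ^ (-(1 / 3 : ℝ)) = 2 * powScale (1 / 3) β := by rw [powScale_eq hβ1]
      have h3 := hβl β hββl
      linarith
    -- the core rate at the intermediate exponent `p₁`, `p < p₁ < min(2s, 1/3)`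
    set p₁ : ℝ := (p + min (2 * s) (1 / 3)) / 2 with hp₁
    have hp₁a : p < p₁ := by
      rw [hp₁]; have := lt_min hp2 hp3; linarith
    have hp₁b : p₁ < 2 * s := by
      rw [hp₁]; have := min_le_left (2 * s) (1 / 3); linarith
    have hp₁c : p₁ < 2 / 5 := by
      rw [hp₁]; have := min_le_right (2 * s) (1 / 3); linarith
    have h1 := core_rate_sq_le_powScale (L := L) (D := (517 / (Fintype.card (Site 3 L) : ℝ))) (Cp := Cp) (Cq := Cq) hs0 (by linarith) hD0 hCp hp₁b hp₁c
    obtain ⟨βc, hβc⟩ := Summit.QuantumFields.YangMills.Theorems.TwistedTraceScaling.Negative.R23.mul_powScale_le_eventually (a := p₁) (b := p) hp₁a 1 (D := 1 / 8) (by norm_num)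
    have htail2 : ∀ᶠ β : ℝ in atTop, Real.log β ^ 4 / 4 ≤ β * btMnt L ((517 / (Fintype.card (Site 3 L) : ℝ)) * powScale s β) (powScale (1 / 2) β * btLog β ^ 2) (min (1 / 40) (powScale (1 / 2) β * btLog β)) (5 * (powScale (1 / 2) β * btLog β ^ 2)) (powScale 1 β) ∧
        q₀ * Real.log β ^ 4 ≤ β * btMfar L ((517 / (Fintype.card (Site 3 L) : ℝ)) * powScale s β) (powScale (1 / 2) β * btLog β ^ 2) (min (1 / 40) (powScale (1 / 2) β * btLog β)) (powScale 1 β) (13 * ((517 / (Fintype.card (Site 3 L) : ℝ)) * powScale s β)) := by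
      filter_upwards [htailE] with β h; exact ⟨h.2.2.2.2.2.2.1, h.2.2.2.2.2.2.2⟩
    have h2r := tail_rate_small (L := L) hs0 Cw (517 / (Fintype.card (Site 3 L) : ℝ)) hq₀ hcR' K' htail2
    have h3r := out_rate_small_magnetic (L := L) hL2 hs0 Cw hcR K
    have h4r := shell_rate_small (L := L) hL2 hs0 Cw Cn
    refine rate_le_of_pieces (B := fun β => powScale p β) (b₁ := fun β => ((max (1 - Real.exp (-(coreEta L β ((517 / (Fintype.card (Site 3 L) : ℝ)) * powScale s β) (((517 / (Fintype.card (Site 3 L) : ℝ)) * powScale s β) + (14 * powScale s β)) (9 * (L : ℝ) * (5 * (powScale (1 / 2) β * btLog β ^ 2)) + (powScale 1 β)) (min (1 / 40) (powScale (1 / 2) β * btLog β)) ((powScale 1 β) * Fintype.card (Site 3 L)) (powScale (2 * s) β) + coreEps1 L β ((517 / (Fintype.card (Site 3 L) : ℝ)) * powScale s β) (9 * (L : ℝ) * (5 * (powScale (1 / 2) β * btLog β ^ 2)) + (powScale 1 β)) (min (1 / 40) (powScale (1 / 2) β * btLog β)) + coreEps2 L β ((517 / (Fintype.card (Site 3 L)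 : ℝ)) * powScale s β) (9 * (L : ℝ) * (5 * (powScale (1 / 2) β * btLog β ^ 2)) + (powScale 1 β)) (min (1 / 40) (powScale (1 / 2) β * btLog β)) (powScale (2 * s) β))) * (1 - powScale (1 / 5) β)) (Real.exp (coreEta L β ((517 / (Fintype.card (Site 3 L) : ℝ)) * powScale s β) (((517 / (Fintype.card (Site 3 L) : ℝ)) * powScale s β) + (14 * powScale s β)) (9 * (L : ℝ) * (5 * (powScale (1 / 2) β * btLog β ^ 2)) + (powScale 1 β)) (min (1 / 40) (powScale (1 / 2) β * btLog β)) ((powScale 1 β) * Fintype.card (Site 3 L)) (powScale (2 * s) β) + coreEps1 L β ((517 / (Fintype.card (Site 3 L) : ℝ)) * powScale s β) (9 * (L : ℝ) * (5 * (powScale (1 / 2) β * btLog β ^ 2)) + (powScale 1 β)) (min (1 / 40) (powScale (1 / 2) β * btLog β)) + coreEps2 L β ((517 / (Fintype.card (Site 3 L) : ℝ)) * powScale s β) (9 * (L : ℝ) * (5 * (powScale (1 / 2) β * btLog β ^ 2)) + (powScale 1 β)) (min (1 / 40) (powScale (1 / 2) β * btLog β)) (powScale (2 * s) β)) * (1 +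 powScale (1 / 5) β) - 1) + (Cp * (43 * powScale s β) ^ 2)) * Real.sqrt (8 / ((1 - (Cp * (43 * powScale s β) ^ 2)) * (1 - powScale (1 / 5) β) ^ 2 * (1 - (Cq * (43 * powScale s β) ^ 2))))))
      (b₂ := fun β => Real.sqrt (((Real.exp (β * (2 * (Fintype.card (Edge 3 L) : ℝ))) * (Real.exp (-(β * btMnt L ((517 / (Fintype.card (Site 3 L) : ℝ)) * powScale s β) (powScale (1 / 2) β * btLog β ^ 2) (min (1 / 40) (powScale (1 / 2) β * btLog β)) (5 * (powScale (1 / 2) β * btLog β ^ 2)) (powScale 1 β))) + Real.exp (-(β * btMfar L ((517 / (Fintype.card (Site 3 L) : ℝ)) * powScale s β) (powScale (1 / 2) β * btLog β ^ 2) (min (1 / 40) (powScale (1 / 2) β * btLog β)) (powScale 1 β) (13 * ((517 / (Fintype.card (Site 3 L) : ℝ)) * powScale s β))))) * ∫ v, (fun x : LinkSpace L => {x : LinkSpace L | linkCurry x ∈ capBalancedSet L}.indicator (fun _ => (1 : ℝ)) x * frozenProfile L (fun β' => stiffGaussExp L (β' / 2) β') (fun β' => min (1 / 40) (powScale (1 /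 2) β' * btLog β')) β x) (linkEmbed L v) ∂orthoTransverse L) ^ 2 * (1 / (fpWeightBar L (powScale 1 β) * (1 - (Cw * (43 * powScale s β) ^ 2))))) / (cR' * powScale 1 β ^ K' * (Real.exp (2 * β) ^ Fintype.card (Edge 3 L)) ^ 2))) (b₃ := fun β => Real.sqrt ((3 * ((orthoTransverse L Set.univ).toReal * (1 / (fpWeightBar L (powScale 1 β) * (1 - (Cw * (43 * powScale s β) ^ 2)))) * ((Real.exp (2 * β) ^ Fintype.card (Edge 3 L)) ^ 2 * (Real.exp (-(β * (2 - 2 * Real.cos (2 * Real.pi / L)) * ((min (1 / 40) (powScale (1 / 2) β * btLog β)) / 12 / 2) ^ 2)) + Real.exp (-(((powScale 1 β) * btLog β) ^ 2 / powScale 1 β ^ 2)) ^ 2 + Real.exp (-(((powScale 1 β) * btLog β) ^ 2 / powScale 1 β ^ 2))) + (Real.exp (2 * β) ^ Fintype.card (Edge 3 L)) * ((Real.exp (2 * β) ^ Fintype.card (Edge 3 L)) * Real.exp (-(β / 2 * ((2 - 2 * Real.cos (2 * Real.pi / L)) / 16 * ((min (1 / 40) (powScale (1 / 2) β * btLog β))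 / 12) ^ 2))))))) / (cR * powScale 1 β ^ K * (Real.exp (2 * β) ^ Fintype.card (Edge 3 L)) ^ 2))) (b₄ := fun β => Real.sqrt (8 * (fpWeightBar L (powScale 1 β) * (1 + (Cw * (43 * powScale s β) ^ 2))) * (Real.exp (-(β * (2 - 2 * Real.cos (2 * Real.pi / L)) * ((min (1 / 40) (powScale (1 / 2) β * btLog β)) / 12) ^ 2)) * (orthoTransverse L Set.univ).toReal) / ((1 - powScale (1 / 5) β) ^ 2 * (1 - (Cn * (43 * powScale s β) ^ 2)) * (∫ v, {v : Edge 3 L → Fin 3 → ℝ | ‖linkEmbed L v‖ ≤ (min (1 / 40) (powScale (1 / 2) β * btLog β)) / 12}.indicator (fun _ => (1 : ℝ)) v * (Real.exp (-(stiffGaussExp L (β / 2) β (linkEmbed L v))) ^ 2 * Real.exp (-(‖(gaugeModes L).starProjection (linkEmbed L v)‖ ^ 2 / powScale 1 β ^ 2))) ∂orthoTransverse L) * fpWeightBar L (powScale 1 β)))) ?_ ?_ ?_ ?_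
    · filter_upwards [h1, eventually_ge_atTop βc] with β h hβ
      have := hβc β hβ
      linarith
    · filter_upwards [h2r 1 one_pos, hlam0, hlam] with β h hl hl'; exact (sqrt_sq_le_of_le h (by positivity)).trans hl'
    · filter_upwards [h3r 1 one_pos, hlam0, hlam] with β h hl hl'; exact (sqrt_sq_le_of_le h (by positivity)).trans hl'
    · filter_upwards [h4r 1 one_pos, hlam0, hlam] with β h hl hl'; exact (sqrt_sq_le_of_le h (by positivity)).trans hl'
  · -- the (OD) clause via `hOD_of_defect`
    have hqfm : ∀ β', Measurable ((fun β' => stiffGaussExp L (β' / 2) β') β') := fun β' => measurable_stiffGaussExp _ _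
    have hqf0 : ∀ β' x, 0 ≤ (fun β' => stiffGaussExp L (β' / 2) β') β' x := fun β' x => stiffGaussExp_nonneg _ _ x
    have hΩm' : ∀ β, Measurable ((fun β' => fun x : LinkSpace L => {x : LinkSpace L | linkCurry x ∈ capBalancedSet L}.indicator (fun _ => (1 : ℝ)) x * frozenProfile L (fun β'' => stiffGaussExp L (β'' / 2) β'') (fun β'' => min (1 / 40) (powScale (1 / 2) β'' * btLog β'')) β' x) β) := fun β => measurable_capRestrict (L := L) (measurable_frozenProfile hqfm _ β)
    have hΩ1' : ∀ β x, |(fun β' => fun x : LinkSpace L => {x : LinkSpace L | linkCurry x ∈ capBalancedSet L}.indicator (fun _ => (1 : ℝ)) x * frozenProfile L (fun β'' => stiffGaussExp L (β'' / 2) β'') (fun β'' => min (1 / 40) (powScale (1 / 2) β'' * btLog β'')) β' x) β x| ≤ 1 := fun β x =>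
      (capRestrict_mem (L := L) (fun x => (frozenProfile_mem_Icc hqf0 _ β x).1) (abs_frozenProfile_le hqf0 _ β) x).2.2
    have hw : ∀ β, Measurable (softWeight ((fun β => (recordChi L s 43 M β)) β)) ∧ (∃ C : ℝ, ∀ U, |softWeight ((fun β => (recordChi L s 43 M β)) β) U| ≤ C) ∧ ∀ U, 0 ≤ softWeight ((fun β => (recordChi L s 43 M β)) β) U :=
      fun β => by
        obtain ⟨hwm, hwb, hw0, -⟩ := softWeight_recordChi_props (L := L) s 43 M β
        exact ⟨hwm, ⟨_, hwb⟩, hw0⟩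
    set Λf : ℝ → ℝ := fun β => (btC L β (fun x : LinkSpace L => {x : LinkSpace L | linkCurry x ∈ capBalancedSet L}.indicator (fun _ => (1 : ℝ)) x * frozenProfile L (fun β' => stiffGaussExp L (β' / 2) β') (fun β' => min (1 / 40) (powScale (1 / 2) β' * btLog β')) β x) (powScale 1 β) (5 * (powScale (1 / 2) β * btLog β ^ 2)) * (fpZ (powScale 1 β))⁻¹ / recordGamma L (fun β' => fun x : LinkSpace L => {x : LinkSpace L | linkCurry x ∈ capBalancedSet L}.indicator (fun _ => (1 : ℝ)) x * frozenProfile L (fun β'' => stiffGaussExp L (β'' / 2) β'') (fun β'' => min (1 / 40) (powScale (1 / 2) β'' * btLog β'')) β' x) β * levelValue su2Rep 1 ((L : ℝ) ^ 3 * β) 0) with hΛf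
    have hΛ : ∀ᶠ β in atTop, 0 ≤ Λf β := by
      filter_upwards [hbtCfl, eventually_ge_atTop (1 : ℝ), eventually_ge_atTop (2 / rStar ^ 3)] with β hbtC hβ1 hβr
      have hβ0 : 0 ≤ β := by linarith
      have hbt : 0 ≤ btC L β (fun x : LinkSpace L => {x : LinkSpace L | linkCurry x ∈ capBalancedSet L}.indicator (fun _ => (1 : ℝ)) x * frozenProfile L (fun β' => stiffGaussExp L (β' / 2) β') (fun β' => min (1 / 40) (powScale (1 / 2) β' * btLog β')) β x) (powScale 1 β) (5 * (powScale (1 / 2) β * btLog β ^ 2)) := le_trans (mul_nonneg hCb.le (pow_nonneg (powScale_pos 1 β).le _)) hbtC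
      have hB0 : 0 ≤ (L : ℝ) ^ 3 * β := mul_nonneg (by positivity) hβ0
      have hB1 : 1 ≤ (L : ℝ) ^ 3 * β := by nlinarith
      have hr0 : 0 ≤ 2 / rStar ^ 3 := by have := rStar_pos; positivity
      have hB2 : 2 / rStar ^ 3 ≤ (L : ℝ) ^ 3 * β := by nlinarith
      have hlam : 0 ≤ levelValue su2Rep 1 ((L : ℝ) ^ 3 * β) 0 := le_trans
        (mul_nonneg (Real.exp_pos _).le (div_nonneg (mul_nonneg (Real.exp_pos _).le (Real.rpow_nonneg hB0 _)) (by norm_num)))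
        (levelValue_one_site_zero_ge hB1 hB2)
      have hγ := recordGamma_record_pos (L := L) hβ0
      simp only [hΛf]
      exact mul_nonneg (div_nonneg (mul_nonneg hbt (inv_pos.2 (fpZ_pos (powScale_pos 1 β))).le) hγ.le) hlam
    have hKW : ∀ᶠ β : ℝ in atTop, Cw * (43 * powScale s β) ^ 2 ≤ 1 / 2 := by
      have h := ((tendsto_powScale hs0).const_mul 43).pow 2 |>.const_mul Cw
      rw [mul_zero, zero_pow two_ne_zero, mul_zero] at h
      exact h.eventually (eventually_le_nhds (by norm_num))
    have hdef : ∀ᶠ β in atTop, ∀ φ : GaugeConfig 3 1 SU2 → ℝ, Measurable φ → (∃ C : ℝ, ∀ u, |φ u| ≤ C) → (∀ u, φ u ≠ 0 → orbitDist u < (fun β => recordDelta1 L s β) β) →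
        ∃ (ψ : GaugeConfig 3 1 SU2 → ℝ) (E : GaugeConfig 3 L SU2 → ℝ), Measurable ψ ∧ (∃ C : ℝ, ∀ u, |ψ u| ≤ C) ∧ Measurable E ∧ (∃ C : ℝ, ∀ U, |E U| ≤ C) ∧
          (∀ U, (fun β => (recordChi L s 43 M β)) β U ≠ 0 → ∫ V, avgKernel β U V * boFun L φ ((fun β' => fun x : LinkSpace L => {x : LinkSpace L | linkCurry x ∈ capBalancedSet L}.indicator (fun _ => (1 : ℝ)) x * frozenProfile L (fun β'' => stiffGaussExp L (β'' / 2) β'') (fun β'' => min (1 / 40) (powScale (1 / 2) β'' * btLog β'')) β' x) β) V ∂configMeasure SU2 L = (boFun L ψ ((fun β' => fun x : LinkSpace L => {x : LinkSpace L | linkCurry x ∈ capBalancedSet L}.indicator (fun _ => (1 : ℝ)) x * frozenProfile L (fun β'' => stiffGaussExp L (β'' / 2) β'') (fun β'' => min (1 / 40) (powScale (1 / 2) β'' * btLog β'')) β' x) β) U + E U) * softWeight ((fun β => (recordChi L s 43 M β)) β) U) ∧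
          ∫ U, E U ^ 2 * softWeight ((fun β => (recordChi L s 43 M β)) β) U ∂configMeasure SU2 L ≤ ((fun β => Real.sqrt (2 * (((max (1 - Real.exp (-(coreEta L β ((517 / (Fintype.card (Site 3 L) : ℝ)) * powScale s β) (((517 / (Fintype.card (Site 3 L) : ℝ)) * powScale s β) + (14 * powScale s β)) (9 * (L : ℝ) * (5 * (powScale (1 / 2) β * btLog β ^ 2)) + (powScale 1 β)) (min (1 / 40) (powScale (1 / 2) β * btLog β)) ((powScale 1 β) * Fintype.card (Site 3 L)) (powScale (2 * s) β) + coreEps1 L β ((517 / (Fintype.card (Site 3 L) : ℝ)) * powScale s β) (9 * (L : ℝ) * (5 * (powScale (1 / 2) β * btLog β ^ 2)) + (powScale 1 β)) (min (1 / 40) (powScale (1 / 2) β * btLog β)) + coreEps2 L β ((517 / (Fintype.card (Site 3 L) : ℝ)) * powScale s β) (9 * (L : ℝ) * (5 * (powScale (1 / 2) β * btLog β ^ 2)) + (powScale 1 β)) (min (1 / 40) (powScale (1 / 2) β * btLog β)) (powScale (2 * s) β))) * (1 - powScale (1 / 5) β)) (Real.exp (coreEta L β ((517 / (Fintype.card (Site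 3 L) : ℝ)) * powScale s β) (((517 / (Fintype.card (Site 3 L) : ℝ)) * powScale s β) + (14 * powScale s β)) (9 * (L : ℝ) * (5 * (powScale (1 / 2) β * btLog β ^ 2)) + (powScale 1 β)) (min (1 / 40) (powScale (1 / 2) β * btLog β)) ((powScale 1 β) * Fintype.card (Site 3 L)) (powScale (2 * s) β) + coreEps1 L β ((517 / (Fintype.card (Site 3 L) : ℝ)) * powScale s β) (9 * (L : ℝ) * (5 * (powScale (1 / 2) β * btLog β ^ 2)) + (powScale 1 β)) (min (1 / 40) (powScale (1 / 2) β * btLog β)) + coreEps2 L β ((517 / (Fintype.card (Site 3 L) : ℝ)) * powScale s β) (9 * (L : ℝ) * (5 * (powScale (1 / 2) β * btLog β ^ 2)) + (powScale 1 β)) (min (1 / 40) (powScale (1 / 2) β * btLog β)) (powScale (2 * s) β)) * (1 + powScale (1 / 5) β) - 1) + (Cp * (43 * powScale s β) ^ 2)) * Real.sqrt (8 / ((1 - (Cp * (43 * powScale s β) ^ 2)) * (1 - powScale (1 / 5) β) ^ 2 * (1 - (Cq * (43 * powScale s β) ^ 2))))) ^ 2 + Real.sqrt (((Real.exp (β *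 (2 * (Fintype.card (Edge 3 L) : ℝ))) * (Real.exp (-(β * btMnt L ((517 / (Fintype.card (Site 3 L) : ℝ)) * powScale s β) (powScale (1 / 2) β * btLog β ^ 2) (min (1 / 40) (powScale (1 / 2) β * btLog β)) (5 * (powScale (1 / 2) β * btLog β ^ 2)) (powScale 1 β))) + Real.exp (-(β * btMfar L ((517 / (Fintype.card (Site 3 L) : ℝ)) * powScale s β) (powScale (1 / 2) β * btLog β ^ 2) (min (1 / 40) (powScale (1 / 2) β * btLog β)) (powScale 1 β) (13 * ((517 / (Fintype.card (Site 3 L) : ℝ)) * powScale s β))))) * ∫ v, (fun x : LinkSpace L => {x : LinkSpace L | linkCurry x ∈ capBalancedSet L}.indicator (fun _ => (1 : ℝ)) x * frozenProfile L (fun β' => stiffGaussExp L (β' / 2) β') (fun β' => min (1 / 40) (powScale (1 / 2) β' * btLog β')) β x) (linkEmbed L v) ∂orthoTransverse L) ^ 2 * (1 / (fpWeightBar L (powScale 1 β) * (1 - (Cw * (43 * powScale s β) ^ 2))))) / (cR' * powScale 1 β ^ K' * (Real.exp (2 * β) ^ Fintype.card (Edge 3 L)) ^ 2)) ^ 2 +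 Real.sqrt ((3 * ((orthoTransverse L Set.univ).toReal * (1 / (fpWeightBar L (powScale 1 β) * (1 - (Cw * (43 * powScale s β) ^ 2)))) * ((Real.exp (2 * β) ^ Fintype.card (Edge 3 L)) ^ 2 * (Real.exp (-(β * (2 - 2 * Real.cos (2 * Real.pi / L)) * ((min (1 / 40) (powScale (1 / 2) β * btLog β)) / 12 / 2) ^ 2)) + Real.exp (-(((powScale 1 β) * btLog β) ^ 2 / powScale 1 β ^ 2)) ^ 2 + Real.exp (-(((powScale 1 β) * btLog β) ^ 2 / powScale 1 β ^ 2))) + (Real.exp (2 * β) ^ Fintype.card (Edge 3 L)) * ((Real.exp (2 * β) ^ Fintype.card (Edge 3 L)) * Real.exp (-(β / 2 * ((2 - 2 * Real.cos (2 * Real.pi / L)) / 16 * ((min (1 / 40) (powScale (1 / 2) β * btLog β)) / 12) ^ 2))))))) / (cR * powScale 1 β ^ K * (Real.exp (2 * β) ^ Fintype.card (Edge 3 L)) ^ 2)) ^ 2 + Real.sqrt (8 * (fpWeightBar L (powScale 1 β) * (1 + (Cw * (43 * powScale s β) ^ 2))) * (Real.exp (-(β * (2 - 2 * Real.cos (2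 * Real.pi / L)) * ((min (1 / 40) (powScale (1 / 2) β * btLog β)) / 12) ^ 2)) * (orthoTransverse L Set.univ).toReal) / ((1 - powScale (1 / 5) β) ^ 2 * (1 - (Cn * (43 * powScale s β) ^ 2)) * (∫ v, {v : Edge 3 L → Fin 3 → ℝ | ‖linkEmbed L v‖ ≤ (min (1 / 40) (powScale (1 / 2) β * btLog β)) / 12}.indicator (fun _ => (1 : ℝ)) v * (Real.exp (-(stiffGaussExp L (β / 2) β (linkEmbed L v))) ^ 2 * Real.exp (-(‖(gaugeModes L).starProjection (linkEmbed L v)‖ ^ 2 / powScale 1 β ^ 2))) ∂orthoTransverse L) * fpWeightBar L (powScale 1 β))) ^ 2))) β * Λf β) ^ 2 * tubeNormSq (softWeight ((fun β => (recordChi L s 43 M β)) β)) (boFun L φ ((fun β' => fun x : LinkSpace L => {x : LinkSpace L | linkCurry x ∈ capBalancedSet L}.indicator (fun _ => (1 : ℝ)) x * frozenProfile L (fun β'' => stiffGaussExp L (β'' / 2) β'') (fun β'' => min (1 / 40) (powScale (1 / 2) β'' * btLog β'')) β' x) β)) := by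
      have h2τ : ∀ᶠ β : ℝ in atTop, 2 * ((fun β : ℝ => (powScale 1 β) * btLog β) β) ≤ (fun β : ℝ => (min (1 / 40) (powScale (1 / 2) β * btLog β)) / 12) β := by
        have ha : ∀ᶠ β : ℝ in atTop, powScale 1 β * btLog β ^ 1 ≤ 1 / 960 :=
          (tendsto_powScale_mul_btLog_pow (p := 1) one_pos 1).eventually (eventually_le_nhds (by norm_num))
        have hb : ∀ᶠ β : ℝ in atTop, powScale (1 / 2) β ≤ 1 / 24 :=
          (tendsto_powScale (σ := 1 / 2) (by norm_num)).eventually (eventually_le_nhds (by norm_num))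
        filter_upwards [ha, hb] with β ha hb
        have hℓ1 : 1 ≤ btLog β := one_le_btLog β
        have hx0 : 0 < powScale (1 / 2) β := powScale_pos _ _
        have e1 : powScale 1 β = powScale (1 / 2) β * powScale (1 / 2) β := by rw [powScale_mul_powScale]; norm_num
        rw [pow_one] at ha
        show 2 * (powScale 1 β * btLog β) ≤ (min (1 / 40) (powScale (1 / 2) β * btLog β)) / 12
        rw [le_div_iff₀ (by norm_num : (0:ℝ) < 12), le_min_iff]
        refine ⟨by linarith, ?_⟩
        rw [e1]
        have : powScale (1 / 2) β * powScale (1 / 2) β * btLog β ≤ 1 / 24 * powScale (1 / 2) β * btLog β :=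
          mul_le_mul_of_nonneg_right (mul_le_mul_of_nonneg_right hb hx0.le) (by linarith)
        linarith
      have hsepE := Summit.QuantumFields.YangMills.Theorems.TwistedTraceScaling.Negative.R59.eventually_hsep_magnetic (L := L) hL2 hs0 hM0 (fun β : ℝ => (min (1 / 40) (powScale (1 / 2) β * btLog β)) / 12) (fun β : ℝ => (powScale 1 β) * btLog β) (fun β : ℝ => recordDelta1 L s β) h2τ
      filter_upwards [hcoreE, hnormE, hflE, hfliE, htailE, hsepE, recordChi_support_split (L := L) hs0 hM0,
        recordGamma_le_two_mul_inner (L := L) hL2, inner_mass_poly_floor (L := L), eventually_ge_atTop (max β₀ 1),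
        eventually_ge_atTop (2 - 2 * Real.cos (2 * Real.pi / L)), eventually_ge_atTop B₀, hKW]
        with β hco hno hflβ hfliβ hta hsepβ hsuppβ hγ2β hM2β hβmax hβg hβB hKWβ φ hφm hφb hφs
      beta_reduce at hsepβ
      obtain ⟨hc₁, -, -, hη, hfloor, hcoreβ⟩ := hco
      obtain ⟨hκN, hnormβ⟩ := hno
      obtain ⟨hLa, hm₁, hm₂, hP3, hP0, hJ, -, -⟩ := hta
      have hβ1 : 1 ≤ β := le_trans (le_max_right _ _) hβmax
      have hβ0 : 0 < β := by linarith
      have hβ₀ : β₀ ≤ β := le_trans (le_max_left _ _) hβmax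
      have hPFβ := hPF β hβ₀
      have hPlo : ∀ U ∈ fatTubeRho L (fun β => 43 * powScale s β) (fun b => M * (43 * powScale s b)) β, fpWeightBar L (powScale 1 β) * (1 - Cw * (43 * powScale s β) ^ 2) ≤ gaugeAvg (recordChi L s 43 M β) U :=
        fun U hU => (hPFβ U hU).1
      have hPhi : ∀ U ∈ fatTubeRho L (fun β => 43 * powScale s β) (fun b => M * (43 * powScale s b)) β, gaugeAvg (recordChi L s 43 M β) U ≤ fpWeightBar L (powScale 1 β) * (1 + Cw * (43 * powScale s β) ^ 2) :=
        fun U hU => (hPFβ U hU).2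
      have hNb : 0 < fpWeightBar L (powScale 1 β) := fpWeightBar_pos L (powScale_pos 1 β)
      have hKW1 : Cw * (43 * powScale s β) ^ 2 < 1 := by linarith
      have hNκ : 0 < fpWeightBar L (powScale 1 β) * (1 - Cw * (43 * powScale s β) ^ 2) := mul_pos hNb (by linarith)
      have hNhi : 0 ≤ fpWeightBar L (powScale 1 β) * (1 + Cw * (43 * powScale s β) ^ 2) := by positivity
      have hwS := softWeight_recordChi_ge (L := L) hNκ hPlo
      have hM2 : 0 < (∫ v, {v : Edge 3 L → Fin 3 → ℝ | ‖linkEmbed L v‖ ≤ (min (1 / 40) (powScale (1 / 2) β * btLog β)) / 12}.indicator (fun _ => (1 : ℝ)) v * (Real.exp (-(stiffGaussExp L (β / 2) β (linkEmbed L v))) ^ 2 * Real.exp (-(‖(gaugeModes L).starProjection (linkEmbed L v)‖ ^ 2 / powScale 1 β ^ 2))) ∂orthoTransverse L) := lt_of_lt_of_le (mul_pos (mul_pos (Real.exp_pos _) (pow_pos (by positivity) _)) (pow_pos (powScale_pos 1 β) _)) hM2β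
      have hγ0 := recordGamma_record_pos (L := L) hβ0.le
      have hB : B₀ ≤ (L : ℝ) ^ 3 * β := by nlinarith
      have hCEβ := hCE ((L : ℝ) ^ 3 * β) hB
      have hbtCβ := btC_floor_of_quasimode (L := L) hβ0 hfloor
      have hx0 : 0 < powScale (1 / 2) β := powScale_pos _ _
      have hℓ0 : 0 ≤ btLog β := le_trans zero_le_one (one_le_btLog β)
      have hR₀ : 0 ≤ (min (1 / 40) (powScale (1 / 2) β * btLog β)) / 12 := div_nonneg (le_min (by norm_num) (mul_nonneg hx0.le hℓ0)) (by norm_num)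
      have hτ0 : 0 ≤ (powScale 1 β) * btLog β := mul_nonneg (powScale_pos _ _).le hℓ0
      have hKsep : 0 ≤ Real.exp (2 * β) ^ Fintype.card (Edge 3 L) * Real.exp (-(β / 2 * ((2 - 2 * Real.cos (2 * Real.pi / L)) / 16 * ((min (1 / 40) (powScale (1 / 2) β * btLog β)) / 12) ^ 2))) := by positivity
      have hδw : 14 * powScale s β / Fintype.card (Site 3 L) ≤ (517 / (Fintype.card (Site 3 L) : ℝ)) * powScale s β := recordDelta_le_window _ hN _ (powScale_pos s β).le
      have htailβ : ∀ φ : GaugeConfig 3 1 SU2 → ℝ, Measurable φ → ∀ Cφ : ℝ, (∀ u, |φ u| ≤ Cφ) → (∀ u, φ u ≠ 0 → orbitDist u < 14 * powScale s β / Fintype.card (Site 3 L)) → ∫ U, {U : GaugeConfig 3 L SU2 | U ∈ orthoTubeSet L ∧ (recordChi L s 43 M β) U ≠ 0 ∧ ‖relLinkVec L U‖ ≤ (min (1 / 40) (powScale (1 / 2) β * btLog β)) / 12 ∧ slowMean L U ∈ {u : GaugeConfig 3 1 SU2 | (∀ k : Fin 3, ‖su2Quat (u (0, k)) - 1‖ ≤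 ((517 / (Fintype.card (Site 3 L) : ℝ)) * powScale s β)) ∧ (L : ℝ) ^ 3 * wilsonAction su2Rep u ≤ (powScale (2 * s) β)}}.indicator (fun _ => (1 : ℝ)) U * ((fun U : GaugeConfig 3 L SU2 => (fpZ (powScale 1 β))⁻¹ * ∫ u, φ u * (∫ c, fpFibreTransfer L β (fun x : LinkSpace L => {x : LinkSpace L | linkCurry x ∈ capBalancedSet L}.indicator (fun _ => (1 : ℝ)) x * frozenProfile L (fun β' => stiffGaussExp L (β' / 2) β') (fun β' => min (1 / 40) (powScale (1 / 2) β' * btLog β')) β x) (tailWeight L (powScale 1 β) (5 * (powScale (1 / 2) β * btLog β ^ 2))) (gaugeTransform (fun _ : Site 3 L => c⁻¹) U) u ∂haarProbability SU2) ∂configMeasure SU2 1) U ^ 2 / softWeight (recordChi L s 43 M β) U) ∂configMeasure SU2 L ≤ ((fpZ (powScale 1 β))⁻¹ * (Real.exp (β * (2 * (Fintype.card (Edge 3 L) : ℝ))) * (Real.exp (-(β * btMnt L ((517 / (Fintype.card (Site 3 L) : ℝ)) * powScale s β) (powScale (1 / 2) β * btLog β ^ 2) (min (1 / 40) (powScale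 (1 / 2) β * btLog β)) (5 * (powScale (1 / 2) β * btLog β ^ 2)) (powScale 1 β))) + Real.exp (-(β * btMfar L ((517 / (Fintype.card (Site 3 L) : ℝ)) * powScale s β) (powScale (1 / 2) β * btLog β ^ 2) (min (1 / 40) (powScale (1 / 2) β * btLog β)) (powScale 1 β) (13 * ((517 / (Fintype.card (Site 3 L) : ℝ)) * powScale s β))))) * ∫ v, (fun x : LinkSpace L => {x : LinkSpace L | linkCurry x ∈ capBalancedSet L}.indicator (fun _ => (1 : ℝ)) x * frozenProfile L (fun β' => stiffGaussExp L (β' / 2) β') (fun β' => min (1 / 40) (powScale (1 / 2) β' * btLog β')) β x) (linkEmbed L v) ∂orthoTransverse L)) ^ 2 * (1 / (fpWeightBar L (powScale 1 β) * (1 - Cw * (43 * powScale s β) ^ 2))) * ∫ u, φ u ^ 2 ∂configMeasure SU2 1 :=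
        fun φ' hφm' Cφ' hCφ' hφs' => tail_sq_integral_le (L := L) hβ0.le hNκ hPlo (le_refl _) hLa hm₁ hm₂ hP3 hP0 hJ hφm' hCφ' (slow_window_of_orbitDist hδw hφs')
      have houtβ : ∀ φ : GaugeConfig 3 1 SU2 → ℝ, Measurable φ → ∀ Cφ : ℝ, (∀ u, |φ u| ≤ Cφ) → (∀ u, φ u ≠ 0 → orbitDist u < 14 * powScale s β / Fintype.card (Site 3 L)) → ∫ U, (orthoTubeSet L ∩ {U | (recordChi L s 43 M β) U ≠ 0} ∩ {U | (min (1 / 40) (powScale (1 / 2) β * btLog β)) / 12 < ‖relLinkVec L U‖}).indicator (fun _ => (1 : ℝ)) U * ((∫ V, avgKernel β U V * boFun L φ (fun x : LinkSpace L => {x : LinkSpace L | linkCurry x ∈ capBalancedSet L}.indicator (fun _ => (1 : ℝ)) x * frozenProfile L (fun β' => stiffGaussExp L (β' / 2) β') (fun β' => min (1 / 40) (powScale (1 / 2) β' * btLog β')) β x) V ∂configMeasure SU2 L) ^ 2 / softWeight (recordChi L s 43 M β) U) ∂configMeasure SU2 L ≤ 3 * ((orthoTransverse L Set.univ).toReal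 * (1 / (fpWeightBar L (powScale 1 β) * (1 - Cw * (43 * powScale s β) ^ 2))) * ((Real.exp (2 * β) ^ Fintype.card (Edge 3 L)) ^ 2 * (Real.exp (-(β * (2 - 2 * Real.cos (2 * Real.pi / L)) * ((min (1 / 40) (powScale (1 / 2) β * btLog β)) / 12 / 2) ^ 2)) + Real.exp (-(((powScale 1 β) * btLog β) ^ 2 / powScale 1 β ^ 2)) ^ 2 + Real.exp (-(((powScale 1 β) * btLog β) ^ 2 / powScale 1 β ^ 2))) + (Real.exp (2 * β) ^ Fintype.card (Edge 3 L)) * ((Real.exp (2 * β) ^ Fintype.card (Edge 3 L)) * Real.exp (-(β / 2 * ((2 - 2 * Real.cos (2 * Real.pi / L)) / 16 * ((min (1 / 40) (powScale (1 / 2) β * btLog β)) / 12) ^ 2))))) * ∫ u, φ u ^ 2 ∂configMeasure SU2 1) :=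
        fun φ' hφm' Cφ' hCφ' hφs' => out_sq_integral_le_of_sep (L := L) hL2 hβ1 hβg hNκ hPlo hφm' hCφ'
          (slow_window_of_orbitDist (δ := recordDelta1 L s β) (le_of_eq rfl) hφs') hR₀ hτ0 hKsep hsepβ
      have hshellβ : ∀ φ : GaugeConfig 3 1 SU2 → ℝ, Measurable φ → ∀ Cφ : ℝ, (∀ u, |φ u| ≤ Cφ) → (∀ u, φ u ≠ 0 → orbitDist u < 14 * powScale s β / Fintype.card (Site 3 L)) → ∫ U, (orthoTubeSet L ∩ {U | (recordChi L s 43 M β) U ≠ 0} ∩ {U | (min (1 / 40) (powScale (1 / 2) β * btLog β)) / 12 < ‖relLinkVec L U‖}).indicator (fun _ => (1 : ℝ)) U * (boFun L (fun u' => (fpZ (powScale 1 β))⁻¹ * (c₁ β * stiffGaussTop L (β / 2) β / (∫ u, ({u : GaugeConfig 3 1 SU2 | (∀ k : Fin 3, ‖su2Quat (u (0, k)) - 1‖ ≤ (powScale (1 / 3) β)) ∧ (L : ℝ) ^ 3 * wilsonAction su2Rep u ≤ (powScale (1 / 2) β)}.indicator (fun _ => (1 : ℝ))) u * (transferKernel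 su2Rep ((L : ℝ) ^ 3 * β) (1 : GaugeConfig 3 1 SU2) u / transferKernel su2Rep ((L : ℝ) ^ 3 * β) (1 : GaugeConfig 3 1 SU2) 1) ∂configMeasure SU2 1)) / (fpWeightBar L (powScale 1 β)) * (∫ u, φ u * (avgKernel ((L : ℝ) ^ 3 * β) u' u / transferKernel su2Rep ((L : ℝ) ^ 3 * β) (1 : GaugeConfig 3 1 SU2) 1) ∂configMeasure SU2 1)) (fun x : LinkSpace L => {x : LinkSpace L | linkCurry x ∈ capBalancedSet L}.indicator (fun _ => (1 : ℝ)) x * frozenProfile L (fun β' => stiffGaussExp L (β' / 2) β') (fun β' => min (1 / 40) (powScale (1 / 2) β' * btLog β')) β x) U ^ 2 * softWeight (recordChi L s 43 M β) U) ∂configMeasure SU2 L ≤ (fpWeightBar L (powScale 1 β) * (1 + Cw * (43 * powScale s β) ^ 2)) * Real.exp (-(β * (2 - 2 * Real.cos (2 * Real.pi / L)) * ((min (1 / 40) (powScale (1 / 2) β * btLog β)) / 12) ^ 2)) * (orthoTransverse L Set.univ).toReal *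
          ((((fpZ (powScale 1 β))⁻¹ * (c₁ β * stiffGaussTop L (β / 2) β / (∫ u, ({u : GaugeConfig 3 1 SU2 | (∀ k : Fin 3, ‖su2Quat (u (0, k)) - 1‖ ≤ (powScale (1 / 3) β)) ∧ (L : ℝ) ^ 3 * wilsonAction su2Rep u ≤ (powScale (1 / 2) β)}.indicator (fun _ => (1 : ℝ))) u * (transferKernel su2Rep ((L : ℝ) ^ 3 * β) (1 : GaugeConfig 3 1 SU2) u / transferKernel su2Rep ((L : ℝ) ^ 3 * β) (1 : GaugeConfig 3 1 SU2) 1) ∂configMeasure SU2 1)) / (fpWeightBar L (powScale 1 β))) ^ 2 * ((linkCE ((L : ℝ) ^ 3 * β) / transferKernel su2Rep ((L : ℝ) ^ 3 * β) (1 : GaugeConfig 3 1 SU2) 1) ^ 2 * ∫ u, φ u ^ 2 ∂configMeasure SU2 1))) :=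
        fun φ' hφm' Cφ' hCφ' _ => shell_dualBO_sq_integral_le (L := L) hL2 hβ1 hβg hPhi hNhi hφm' hCφ' (c₁ β * stiffGaussTop L (β / 2) β / (∫ u, ({u : GaugeConfig 3 1 SU2 | (∀ k : Fin 3, ‖su2Quat (u (0, k)) - 1‖ ≤ (powScale (1 / 3) β)) ∧ (L : ℝ) ^ 3 * wilsonAction su2Rep u ≤ (powScale (1 / 2) β)}.indicator (fun _ => (1 : ℝ))) u * (transferKernel su2Rep ((L : ℝ) ^ 3 * β) (1 : GaugeConfig 3 1 SU2) u / transferKernel su2Rep ((L : ℝ) ^ 3 * β) (1 : GaugeConfig 3 1 SU2) 1) ∂configMeasure SU2 1)) hR₀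
      have H := hdef_fixed_magnetic (L := L) (D := (517 / (Fintype.card (Site 3 L) : ℝ))) (Dδ := (517 / (Fintype.card (Site 3 L) : ℝ))) hβ0 hCw hKW1 hκN hη hcR hcR' hc₁ hM2 hγ0 hNκ hwS hsuppβ hcoreβ htailβ houtβ hshellβ hflβ hfliβ hbtCβ hnormβ hγ2β hCEβ
        φ hφm hφb hφs
      exact H
    have hOD := hOD_of_defect (L := L) (Ω := (fun β' => fun x : LinkSpace L => {x : LinkSpace L | linkCurry x ∈ capBalancedSet L}.indicator (fun _ => (1 : ℝ)) x * frozenProfile L (fun β'' => stiffGaussExp L (β'' / 2) β'') (fun β'' => min (1 / 40) (powScale (1 / 2) β'' * btLog β'')) β' x)) (χ := fun β => (recordChi L s 43 M β)) (δ₁ := fun β => recordDelta1 L s β) (Λ := Λf) (b := fun β => Real.sqrt (2 * (((max (1 - Real.exp (-(coreEta L β ((517 / (Fintype.card (Site 3 L) : ℝ)) * powScale s β) (((517 / (Fintype.card (Site 3 L) : ℝ)) * powScale s β) + (14 * powScale s β)) (9 * (L : ℝ) * (5 * (powScale (1 / 2) β * btLog β ^ 2)) + (powScale 1 β)) (min (1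 / 40) (powScale (1 / 2) β * btLog β)) ((powScale 1 β) * Fintype.card (Site 3 L)) (powScale (2 * s) β) + coreEps1 L β ((517 / (Fintype.card (Site 3 L) : ℝ)) * powScale s β) (9 * (L : ℝ) * (5 * (powScale (1 / 2) β * btLog β ^ 2)) + (powScale 1 β)) (min (1 / 40) (powScale (1 / 2) β * btLog β)) + coreEps2 L β ((517 / (Fintype.card (Site 3 L) : ℝ)) * powScale s β) (9 * (L : ℝ) * (5 * (powScale (1 / 2) β * btLog β ^ 2)) + (powScale 1 β)) (min (1 / 40) (powScale (1 / 2) β * btLog β)) (powScale (2 * s) β))) * (1 - powScale (1 / 5) β)) (Real.exp (coreEta L β ((517 / (Fintype.card (Site 3 L) : ℝ)) * powScale s β) (((517 / (Fintype.card (Site 3 L) : ℝ)) * powScale s β) + (14 * powScale s β)) (9 * (L : ℝ) * (5 * (powScale (1 / 2) β * btLog β ^ 2)) + (powScale 1 β)) (min (1 / 40) (powScale (1 / 2) β * btLog β)) ((powScale 1 β) * Fintype.card (Site 3 L)) (powScale (2 * s) β) + coreEps1 L β ((517 / (Fintype.card (Site 3 L) : ℝ)) * powScale s β) (9 * (L :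 ℝ) * (5 * (powScale (1 / 2) β * btLog β ^ 2)) + (powScale 1 β)) (min (1 / 40) (powScale (1 / 2) β * btLog β)) + coreEps2 L β ((517 / (Fintype.card (Site 3 L) : ℝ)) * powScale s β) (9 * (L : ℝ) * (5 * (powScale (1 / 2) β * btLog β ^ 2)) + (powScale 1 β)) (min (1 / 40) (powScale (1 / 2) β * btLog β)) (powScale (2 * s) β)) * (1 + powScale (1 / 5) β) - 1) + (Cp * (43 * powScale s β) ^ 2)) * Real.sqrt (8 / ((1 - (Cp * (43 * powScale s β) ^ 2)) * (1 - powScale (1 / 5) β) ^ 2 * (1 - (Cq * (43 * powScale s β) ^ 2))))) ^ 2 + Real.sqrt (((Real.exp (β * (2 * (Fintype.card (Edge 3 L) : ℝ))) * (Real.exp (-(β * btMnt L ((517 / (Fintype.card (Site 3 L) : ℝ)) * powScale s β) (powScale (1 / 2) β * btLog β ^ 2) (min (1 / 40) (powScale (1 / 2) β * btLog β)) (5 * (powScale (1 / 2) β * btLog β ^ 2)) (powScale 1 β))) + Real.exp (-(β * btMfar L ((517 / (Fintype.card (Site 3 L) : ℝ)) * powScale s β) (powScale (1 / 2) β * btLog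 β ^ 2) (min (1 / 40) (powScale (1 / 2) β * btLog β)) (powScale 1 β) (13 * ((517 / (Fintype.card (Site 3 L) : ℝ)) * powScale s β))))) * ∫ v, (fun x : LinkSpace L => {x : LinkSpace L | linkCurry x ∈ capBalancedSet L}.indicator (fun _ => (1 : ℝ)) x * frozenProfile L (fun β' => stiffGaussExp L (β' / 2) β') (fun β' => min (1 / 40) (powScale (1 / 2) β' * btLog β')) β x) (linkEmbed L v) ∂orthoTransverse L) ^ 2 * (1 / (fpWeightBar L (powScale 1 β) * (1 - (Cw * (43 * powScale s β) ^ 2))))) / (cR' * powScale 1 β ^ K' * (Real.exp (2 * β) ^ Fintype.card (Edge 3 L)) ^ 2)) ^ 2 + Real.sqrt ((3 * ((orthoTransverse L Set.univ).toReal * (1 / (fpWeightBar L (powScale 1 β) * (1 - (Cw * (43 * powScale s β) ^ 2)))) * ((Real.exp (2 * β) ^ Fintype.card (Edge 3 L)) ^ 2 * (Real.exp (-(β * (2 - 2 * Real.cos (2 * Real.pi / L)) * ((min (1 / 40) (powScale (1 / 2) β * btLog β)) / 12 / 2) ^ 2)) + Real.exp (-(((powScale 1 β) * btLog β) ^ 2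 / powScale 1 β ^ 2)) ^ 2 + Real.exp (-(((powScale 1 β) * btLog β) ^ 2 / powScale 1 β ^ 2))) + (Real.exp (2 * β) ^ Fintype.card (Edge 3 L)) * ((Real.exp (2 * β) ^ Fintype.card (Edge 3 L)) * Real.exp (-(β / 2 * ((2 - 2 * Real.cos (2 * Real.pi / L)) / 16 * ((min (1 / 40) (powScale (1 / 2) β * btLog β)) / 12) ^ 2))))))) / (cR * powScale 1 β ^ K * (Real.exp (2 * β) ^ Fintype.card (Edge 3 L)) ^ 2)) ^ 2 + Real.sqrt (8 * (fpWeightBar L (powScale 1 β) * (1 + (Cw * (43 * powScale s β) ^ 2))) * (Real.exp (-(β * (2 - 2 * Real.cos (2 * Real.pi / L)) * ((min (1 / 40) (powScale (1 / 2) β * btLog β)) / 12) ^ 2)) * (orthoTransverse L Set.univ).toReal) / ((1 - powScale (1 / 5) β) ^ 2 * (1 - (Cn * (43 * powScale s β) ^ 2)) * (∫ v, {v : Edge 3 L → Fin 3 → ℝ | ‖linkEmbed L v‖ ≤ (min (1 / 40) (powScale (1 / 2) β * btLog β)) / 12}.indicator (fun _ => (1 : ℝ)) v * (Real.exp (-(stiffGaussExp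 L (β / 2) β (linkEmbed L v))) ^ 2 * Real.exp (-(‖(gaugeModes L).starProjection (linkEmbed L v)‖ ^ 2 / powScale 1 β ^ 2))) ∂orthoTransverse L) * fpWeightBar L (powScale 1 β))) ^ 2)))
      hΩm' hΩ1' hw hΛ (fun β => Real.sqrt_nonneg _) hdef
    have hΛe : Λf = fun β => ((btC L β (fun x : LinkSpace L => {x : LinkSpace L | linkCurry x ∈ capBalancedSet L}.indicator (fun _ => (1 : ℝ)) x * frozenProfile L (fun β' => stiffGaussExp L (β' / 2) β') (fun β' => min (1 / 40) (powScale (1 / 2) β' * btLog β')) β x) (btEps β) (5 * (powScale (1 / 2) β * btLog β ^ 2)) / fpZ (btEps β) / recordGamma L (fun β' => fun x : LinkSpace L => {x : LinkSpace L | linkCurry x ∈ capBalancedSet L}.indicator (fun _ => (1 : ℝ)) x * frozenProfile L (fun β'' => stiffGaussExp L (β'' / 2) β'') (fun β'' => min (1 / 40) (powScale (1 / 2) β'' * btLog β'')) β' x) β) * levelValue su2Rep 1 ((L : ℝ) ^ 3 * β) 0) := funext fun β => sigma_forms_eq _ _ _ _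
    rw [hΛe] at hOD
    exact hOD

end Summit.QuantumFields.YangMills.Theorems.FemtoTransferGap.TwoLattice.ConstTube

end
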